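import Literature.AlgebraicGeometry.Frobenioids.UnitTrivializationModelComparisonCanonical
import Literature.AlgebraicGeometry.Frobenioids.PerfectionModelFull
import Literature.AlgebraicGeometry.Frobenioids.PerfectionFunctorialityComplements
import Literature.AlgebraicGeometry.Frobenioids.FrobenioidNatIso
import Literature.AlgebraicGeometry.Frobenioids.PreFrobenioidEquivalenceTransport
import HarnessLib

/-!
# Frobenioids I, Prop. 5.3: `(C^un-tr)^pf` is equivalent to the model Frobenioid of the perfected data
# `(Φ^pf, (Φ^birat)^pf)` — row P53/L04 at THE constructions

Mochizuki, *The geometry of Frobenioids I: the general theory*, Kyushu J. Math. **62** (2008) 293–400,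
§5, Prop. 5.3 p. 103 ll. 16–19 [cite: MochizukiFrdI2008, Prop. 5.3 p.103]: "Moreover, the Frobenioid
`C^un-tr` (respectively, `(C^un-tr)^pf`) … is of model type … and may be obtained as the model Frobenioid
associated to the divisor monoid `Φ` (respectively, `Φ^pf`) … and the rational function monoid `Φ^birat`
(respectively, `ℚ · Φ^birat = Φ^birat ⊗_ℤ ℚ = (Φ^birat)^pf`)"; proof p. 103 ll. 34–36 ("follow immediately
from the definitions and Theorem 5.2, (ii), (iv)"); Prop. 5.5 (iv) p. 104 (perfection of a model Frobenioid).

PROOF-ONLY assembly (cell abc-iut, sub-DAG `plan/L1/SUBDAG-FrdI-Prop53-Cor54.md` row P53/L04, released to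
this seat by the W3 holder abc-iut-w5-d137; seat abc-iut-L1-d5 gen 4). For a Frobenioid `C → F_Φ` (`hF`),
THE perfection `(C^un-tr)^pf` (seat abc-iut-L1-d9's `PreFrobenioid.Perfection (isFrobenioid_untr hF)`) is
compared with the model Frobenioid of the perfected data in three landed steps:
* `C^un-tr ≌ untrModel F` — this lineage's `PreFrobenioid.untrComparison` (Thm. 5.2 (iv) at `C^un-tr`,
  `UnitTrivializationModelComparisonCanonical.lean`), compatible with the functors to `F_Φ`; hence
  (`isFrobeniusCompatible_untrComparison`, via seat abc-iut-L6-t9's `FrobenioidNatIso` dictionary and seat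
  abc-iut-L6-t6's `PreFrobenioidEquivalenceTransport`) it carries arrows of Frobenius type to arrows of
  Frobenius type of the same degree, so that
* its perfection `(C^un-tr)^pf ⥤ (untrModel F)^pf` (seat abc-iut-L1-d9/d1's `Perfection.map`) is an
  equivalence (`Perfection.map_isEquivalence`) lying over `D` (`nonempty_map_untrComparison_baseIso`, from
  `Perfection.baseMap_repMap_comp`), and
* `(untrModel F)^pf ≌` the model Frobenioid of `(Φ^pf, (Φ^birat)^pf, Div^pf)` — Prop. 5.5 (iv) for THE
  perfection of a model Frobenioid (seats abc-iut-w5-d120 / L1-d9, `Perfection.ModelPf.toModelPf_isEquivalence`,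
  over `D` by `toModelPfBaseIso`).
Result: `PreFrobenioid.exists_untrPf_comparison_overBase`. Hypotheses BY NAME, in the currency of the
Prop. 5.5 sub-DAG: the standing hypotheses of Thm. 5.2 for the data `(Φ, Φ^birat)` (`ModelFrobenioid.Hypotheses`,
whose only non-automatic clause is "`Φ^birat` is a monoid on `D`", row P53/L02d) and perfected divisor data
`Div^pf` (`IsPerfectedDiv`, the binder of the typed slot `FrdI.Prop55Sub.Prop55iv_pf`). The identification
of the perfected data `((Φ^birat)^pf, Div^pf)` with seat abc-iut-L1-t5's rendering `ℚ · Φ^birat ⊆ (Φ^pf)^gp`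
(`GpSubfunctor.perfection`, the data of `PreFrobenioid.untrPfModel`) is NOT made here (recorded residual of
the schema `PreFrobenioid.Prop53_untrPf`). No definitions; nothing here bears on [IUTchIII] Cor. 3.12.
-/

noncomputable section

namespace Literature.AlgebraicGeometry.Frobenioids

open CategoryTheory Opposite

universe w v v' u u'

namespace PreFrobenioid

variable {D : Type u} [Category.{v} D] {Φ : Dᵒᵖ ⥤ CommMonCat.{w}}
  {C : Type u'} [Category.{v'} C] {F : C ⥤ ElemFrobenioid Φ}

open PreFrobenioidData (ofFunctor)

/-! ### The comparison `C^un-tr ≌ untrModel F` is compatible with arrows of Frobenius type -/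

/-- **`untrComparison` carries arrows of Frobenius type to arrows of Frobenius type of the same Frobenius
degree** (it is `1`-compatible with the functors to `F_Φ`: Frobenius type and `deg_Fr` are read in `F_Φ`
up to the comparison isomorphism). [cite: MochizukiFrdI2008, Thm. 5.2 (iv) p.101] -/
theorem isFrobeniusCompatible_untrComparison (hF : IsFrobenioid F)
    (h : ModelFrobenioid.Hypotheses Φ (biratSubfunctor F).toMonoid) :
    IsFrobeniusCompatible (untrFunctor hF)
      (ModelFrobenioid.toElem Φ (biratSubfunctor F).toMonoid (biratSubfunctor F).incl)
      (untrComparison F hF).functor := by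
  obtain ⟨i⟩ := untrComparison_compToElem hF
  have hP : IsPreFrobenioid Φ
      (ModelFrobenioid.toElem Φ (biratSubfunctor F).toMonoid (biratSubfunctor F).incl) :=
    (h.isFrobenioid Φ (biratSubfunctor F).toMonoid (biratSubfunctor F).incl).isPreFrobenioid
  have hΦ : ∀ A : D, IsSharp (Φ.obj (op A)) := fun A => (hP.isDivisorial A).isSharp
  refine ⟨fun A B f hf => ?_, fun A B f hf => ?_⟩
  · exact (isFrobeniusType_equivalence_iff (untrComparison F hF) hP f).mp
      ((StructureIso.isFrobeniusType_iff i hΦ f).mp hf)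
  · change degFr ((untrComparison F hF).functor ⋙
        ModelFrobenioid.toElem Φ (biratSubfunctor F).toMonoid (biratSubfunctor F).incl) f = _
    exact (StructureIso.degFr_eq i f).symm

/-- `untrComparison` lies over `D` up to the base components `b_A` of the comparison isomorphism:
`Base(e φ) ≫ b_B = b_A ≫ Base(φ)`. [cite: MochizukiFrdI2008, Thm. 5.2 (iv) p.101] -/
theorem base_untrComparison_map_comm (hF : IsFrobenioid F)
    (i : (untrComparison F hF).functor ⋙
        ModelFrobenioid.toElem Φ (biratSubfunctor F).toMonoid (biratSubfunctor F).incl ≅ untrFunctor hF)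
    {P Q : (ofFunctor Φ F).Untr} (ψ : P ⟶ Q) :
    Base (ModelFrobenioid.toElem Φ (biratSubfunctor F).toMonoid (biratSubfunctor F).incl)
        ((untrComparison F hF).functor.map ψ) ≫ ElemFrobenioid.Base (i.hom.app Q) =
      ElemFrobenioid.Base (i.hom.app P) ≫ Base (untrFunctor hF) ψ := by
  rw [StructureIso.base_eq i ψ, StructureIso.base_hom_inv_app_assoc]
  rfl

/-! ### The perfected comparison `(C^un-tr)^pf ⥤ (untrModel F)^pf` lies over `D` -/

/-- **The perfected comparison lies over `D`**: `(untrComparison)^pf ⋙ Base ≅ Base`, componentwise the base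
components `b_A` of the comparison isomorphism (the chosen Frobenius arrows lie under their sources,
`Perfection.baseMap_repMap_comp`). [cite: MochizukiFrdI2008, Prop. 5.3 p.103] -/
theorem nonempty_map_untrComparison_baseIso (hF : IsFrobenioid F)
    (h : ModelFrobenioid.Hypotheses Φ (biratSubfunctor F).toMonoid) :
    Nonempty (Perfection.map (hF₁ := isFrobenioid_untr hF)
        (hF₂ := h.isFrobenioid Φ (biratSubfunctor F).toMonoid (biratSubfunctor F).incl)
        (isFrobeniusCompatible_untrComparison hF h) ⋙
          (Perfection.ops (h.isFrobenioid Φ (biratSubfunctor F).toMonoid (biratSubfunctor F).incl)).base ≅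
      (Perfection.ops (isFrobenioid_untr hF)).base) := by
  obtain ⟨i⟩ := untrComparison_compToElem hF
  -- notation-free abbreviations
  let G := ModelFrobenioid.toElem Φ (biratSubfunctor F).toMonoid (biratSubfunctor F).incl
  let hG : IsFrobenioid G := h.isFrobenioid Φ (biratSubfunctor F).toMonoid (biratSubfunctor F).incl
  let E := untrComparison F hF
  let hΨ := isFrobeniusCompatible_untrComparison hF h
  refine ⟨NatIso.ofComponents (fun X =>
    { hom := ElemFrobenioid.Base (i.hom.app X.obj)
      inv := ElemFrobenioid.Base (i.inv.app X.obj)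
      hom_inv_id := StructureIso.base_hom_inv_app i X.obj
      inv_hom_id := StructureIso.base_inv_hom_app i X.obj }) ?_⟩
  intro X Y f
  obtain ⟨r, rfl⟩ := Perfection.Hom.mk_surjective f
  change (Perfection.repMap (hF₁ := isFrobenioid_untr hF) (hF₂ := hG) hΨ r).baseMap ≫
      ElemFrobenioid.Base (i.hom.app Y.obj) = ElemFrobenioid.Base (i.hom.app X.obj) ≫ r.baseMap
  haveI : IsIso (Base (untrFunctor hF) (frob (isFrobenioid_untr hF) Y.obj r.L.b)) :=
    isIso_base_frob (isFrobenioid_untr hF) Y.obj r.L.b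
  refine (cancel_mono (Base (untrFunctor hF) (frob (isFrobenioid_untr hF) Y.obj r.L.b))).mp ?_
  -- the four compatibilities to be pasted
  have e₁ := Perfection.baseMap_repMap_comp (hF₁ := isFrobenioid_untr hF) (hF₂ := hG) hΨ r
  have nY := base_untrComparison_map_comm hF i (frob (isFrobenioid_untr hF) Y.obj r.L.b)
  have nX := base_untrComparison_map_comm hF i (frob (isFrobenioid_untr hF) X.obj r.L.a)
  have nr := base_untrComparison_map_comm hF i r.hom
  have e₂ : r.baseMap ≫ Base (untrFunctor hF) (frob (isFrobenioid_untr hF) Y.obj r.L.b) =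
      Base (untrFunctor hF) (frob (isFrobenioid_untr hF) X.obj r.L.a) ≫ Base (untrFunctor hF) r.hom := by
    unfold Perfection.Rep.baseMap
    simp only [Category.assoc, baseInvFrob_base_frob, Category.comp_id]
  calc ((Perfection.repMap (hF₁ := isFrobenioid_untr hF) (hF₂ := hG) hΨ r).baseMap ≫
          ElemFrobenioid.Base (i.hom.app Y.obj)) ≫ Base (untrFunctor hF) (frob (isFrobenioid_untr hF) Y.obj r.L.b)
      = (Perfection.repMap (hF₁ := isFrobenioid_untr hF) (hF₂ := hG) hΨ r).baseMap ≫
          (ElemFrobenioid.Base (i.hom.app Y.obj) ≫ Base (untrFunctor hF) (frob (isFrobenioid_untr hF) Y.obj r.L.b)) :=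
        Category.assoc _ _ _
    _ = (Perfection.repMap (hF₁ := isFrobenioid_untr hF) (hF₂ := hG) hΨ r).baseMap ≫
          (Base G (E.functor.map (frob (isFrobenioid_untr hF) Y.obj r.L.b)) ≫
            ElemFrobenioid.Base (i.hom.app (frobPow (isFrobenioid_untr hF) Y.obj r.L.b))) :=
        (congrArg ((Perfection.repMap (hF₁ := isFrobenioid_untr hF) (hF₂ := hG) hΨ r).baseMap ≫ ·) nY).symm
    _ = ((Perfection.repMap (hF₁ := isFrobenioid_untr hF) (hF₂ := hG) hΨ r).baseMap ≫
          Base G (E.functor.map (frob (isFrobenioid_untr hF) Y.obj r.L.b))) ≫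
            ElemFrobenioid.Base (i.hom.app (frobPow (isFrobenioid_untr hF) Y.obj r.L.b)) :=
        (Category.assoc _ _ _).symm
    _ = (Base G (E.functor.map (frob (isFrobenioid_untr hF) X.obj r.L.a)) ≫ Base G (E.functor.map r.hom)) ≫
            ElemFrobenioid.Base (i.hom.app (frobPow (isFrobenioid_untr hF) Y.obj r.L.b)) :=
        congrArg (· ≫ ElemFrobenioid.Base (i.hom.app (frobPow (isFrobenioid_untr hF) Y.obj r.L.b))) e₁
    _ = Base G (E.functor.map (frob (isFrobenioid_untr hF) X.obj r.L.a)) ≫ (Base G (E.functor.map r.hom) ≫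
            ElemFrobenioid.Base (i.hom.app (frobPow (isFrobenioid_untr hF) Y.obj r.L.b))) :=
        Category.assoc _ _ _
    _ = Base G (E.functor.map (frob (isFrobenioid_untr hF) X.obj r.L.a)) ≫
          (ElemFrobenioid.Base (i.hom.app (frobPow (isFrobenioid_untr hF) X.obj r.L.a)) ≫
            Base (untrFunctor hF) r.hom) :=
        congrArg (Base G (E.functor.map (frob (isFrobenioid_untr hF) X.obj r.L.a)) ≫ ·) nr
    _ = (Base G (E.functor.map (frob (isFrobenioid_untr hF) X.obj r.L.a)) ≫
          ElemFrobenioid.Base (i.hom.app (frobPow (isFrobenioid_untr hF) X.obj r.L.a))) ≫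
            Base (untrFunctor hF) r.hom :=
        (Category.assoc _ _ _).symm
    _ = (ElemFrobenioid.Base (i.hom.app X.obj) ≫ Base (untrFunctor hF) (frob (isFrobenioid_untr hF) X.obj r.L.a)) ≫
            Base (untrFunctor hF) r.hom :=
        congrArg (· ≫ Base (untrFunctor hF) r.hom) nX
    _ = ElemFrobenioid.Base (i.hom.app X.obj) ≫
          (Base (untrFunctor hF) (frob (isFrobenioid_untr hF) X.obj r.L.a) ≫ Base (untrFunctor hF) r.hom) :=
        Category.assoc _ _ _
    _ = ElemFrobenioid.Base (i.hom.app X.obj) ≫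
          (r.baseMap ≫ Base (untrFunctor hF) (frob (isFrobenioid_untr hF) Y.obj r.L.b)) :=
        (congrArg (ElemFrobenioid.Base (i.hom.app X.obj) ≫ ·) e₂).symm
    _ = (ElemFrobenioid.Base (i.hom.app X.obj) ≫ r.baseMap) ≫
          Base (untrFunctor hF) (frob (isFrobenioid_untr hF) Y.obj r.L.b) :=
        (Category.assoc _ _ _).symm

/-! ### Row P53/L04 at THE constructions -/

/-- **[FrdI] Prop. 5.3, `(C^un-tr)^pf` clause, at THE constructions**: for a Frobenioid `C → F_Φ`, THE
perfection of THE unit-trivialisation `(C^un-tr)^pf` is equivalent — over `D` — to the model Frobenioid of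
the perfected data `(Φ^pf, (Φ^birat)^pf, Div^pf)`, granted the standing hypotheses of Thm. 5.2 for
`(Φ, Φ^birat)` (`h`, row P53/L02d being its only non-automatic clause) and perfected divisor data `Div^pf`
(`hDiv`, the binder of the typed Prop. 5.5 (iv) slot): the composite of the perfected comparison
`(C^un-tr)^pf ⥲ (untrModel F)^pf` (Thm. 5.2 (iv) at `C^un-tr` + functoriality of the perfection along
equivalences) with Prop. 5.5 (iv) for the model Frobenioid `untrModel F`. [cite: MochizukiFrdI2008, Prop. 5.3 p.103] -/
theorem exists_untrPf_comparison_overBase (hF : IsFrobenioid F)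
    (h : ModelFrobenioid.Hypotheses Φ (biratSubfunctor F).toMonoid)
    (DivBpf : perfectionFunctor (biratSubfunctor F).toMonoid ⟶ monoidGp (perfectionFunctor Φ))
    (hDiv : IsPerfectedDiv Φ (biratSubfunctor F).toMonoid (biratSubfunctor F).incl DivBpf) :
    ∃ e : Perfection (isFrobenioid_untr hF) ≌
        ModelFrobenioid (perfectionFunctor Φ) (perfectionFunctor (biratSubfunctor F).toMonoid) DivBpf,
      Nonempty (e.functor ⋙ ModelFrobenioid.baseFunctor _ _ _ ≅ (Perfection.ops (isFrobenioid_untr hF)).base) := by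
  let hG : IsFrobenioid (ModelFrobenioid.toElem Φ (biratSubfunctor F).toMonoid (biratSubfunctor F).incl) :=
    h.isFrobenioid Φ (biratSubfunctor F).toMonoid (biratSubfunctor F).incl
  let hΨ := isFrobeniusCompatible_untrComparison hF h
  haveI := Perfection.map_isEquivalence (hF₁ := isFrobenioid_untr hF) (hF₂ := hG) (untrComparison F hF) hΨ
  haveI := Perfection.ModelPf.toModelPf_isEquivalence (hF := hG) DivBpf h.isGroupLike_rat hDiv h.isDivisorial
  obtain ⟨j⟩ := nonempty_map_untrComparison_baseIso hF h
  refine ⟨(Perfection.map (hF₁ := isFrobenioid_untr hF) (hF₂ := hG) hΨ).asEquivalence.trans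
      (Perfection.ModelPf.toModelPf hG DivBpf h.isGroupLike_rat hDiv).asEquivalence, ⟨?_⟩⟩
  exact Functor.associator _ _ _ ≪≫
    Functor.isoWhiskerLeft _ (Perfection.ModelPf.toModelPfBaseIso hG DivBpf h.isGroupLike_rat hDiv) ≪≫ j

end PreFrobenioid

end Literature.AlgebraicGeometry.Frobenioids

end
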